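import Summits.NavierStokesRegularity.NavierStokesRegularity.Theorems.TypeIliouvilleNoTypeII.Negative.NSISuperCascadeWeak
import Summits.NavierStokesRegularity.NavierStokesRegularity.Theorems.TypeIliouvilleNoTypeII.Negative.NSISuperCascadeSingular
import Literature.Barriers.NavierStokesRegularity.NSITypeIIBlowup
import HarnessLib

/-!
# The model-class barrier `NSITypeIIBlowup` holds

Negative-lane support for `Summit.NavierStokesRegularity.NavierStokesRegularity.Theses.TypeILiouville.TypeIliouvilleNoTypeII`
(item `stmt-NavierStokesRegularity-0056`): the kernel discharge of the barrier statement
`Literature.Barriers.NavierStokesRegularity.NSITypeIIBlowup` (filed 2026-08-26 as a bare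
`def … : Prop`, technique class "partial-regularity (CKN / ε-regularity / NSI-energy methods)"):
**there is a `ν₀ > 0` and ONE compactly supported field, smooth in space at every time, which is a
weak solution of the Navier–Stokes inequality for every `ν ∈ [0, ν₀]`, bounded on `[0, T']` for
every `T' < T₀`, singular at `(T₀, x₀)`, with `sup_x |u(t, x)| ≥ c (T₀ - t)^{-β}` for some
`β > 1/2` on `[0, T₀)` — a NON-Type-I rate.**

Assembly of the bricks (D-0081 §B, critic seats 1 and 2):
* B1 `exists_superGain_nsiBlock` — an NSI block `(T, ν₀, τ, z, G, u)` with a super-similar gain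
  `g > τ⁻¹`: `g‖u(0,y)‖ ≤ ‖u(T, τy + z)‖`;
* the amplitude is capped, `a := min g (τ⁻¹ (√τ)⁻¹)`, so that `τ⁻¹ < a ≤ g` AND the energy cap
  `a²τ³ ≤ 1` holds; the clock is `σ := √(τ/a)` (`aσ² = τ`, `σ < 1`, `aσ > 1`,
  `superCascade_params`) — this is an `IsSuperBlock T ν₀ τ σ a z G u`;
* B2 (`NSISuperCascade{Pieces,Strips,Weak}`) — the glued field `glueG T σ τ a z u` is a weak NSI
  solution for every `ν ∈ [0, ν₀]` with `C^∞` slices supported in `G`;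
* B3 (`NSISuperCascadeSingular`) — `(T₀, x₀) = (blowupTime T σ, blowupPoint τ z)` is a singular
  point, the field is bounded before `T₀`, and the rate clause holds with
  `β = log a / log σ⁻² > 1/2`.

What this is NOT: not a statement about the Navier–Stokes equations — the NSI class is strictly
larger (no equation, only the local energy inequality); the theorem says exactly that
ε-regularity / NSI-energy methods cannot by themselves exclude non-Type-I blow-up, i.e. it
certifies the barrier as stated. [folklore] (the `σ = τ`, `a = τ⁻¹` case is
[cite: Ozanski2017NSISingular, §2 pp. 6–7]; the super-similar gain is B1's kernel construction).
-/

noncomputable section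

open MeasureTheory Set Function Filter Topology TopologicalSpace Metric Module
open scoped ENNReal InnerProductSpace RealInnerProductSpace ContDiff Laplacian

set_option linter.dupNamespace false

namespace Summit.NavierStokesRegularity.NavierStokesRegularity.Theorems.TypeIliouvilleNoTypeIINegative

open Literature.Analysis.FluidPDE Literature.Barriers.NavierStokesRegularity
open Literature.Barriers.NavierStokesRegularity.Scheffer

/-- **The barrier statement `NSITypeIIBlowup` holds**: a compactly supported, spatially smooth
weak solution of the Navier–Stokes inequality (for all `ν ∈ [0, ν₀]`, one field) that is bounded
before `T₀`, singular at `(T₀, x₀)`, and blows up at a non-Type-I rate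
`sup_x |u(t,x)| ≥ c (T₀ - t)^{-β}`, `β > 1/2`. Witness: the super-similar switching cascade
`glueG T σ τ a z u` of an NSI block with super-gain (B1), amplitude `a = min g (τ⁻¹(√τ)⁻¹)`,
clock `σ = √(τ/a)`. [folklore] -/
theorem NSITypeIIBlowup_holds : NSITypeIIBlowup := by
  obtain ⟨T, ν₀, τ, z, G, u, g, hblock, hg, hgain⟩ := exists_superGain_nsiBlock
  have hτ₀ := hblock.τ_pos
  have hτ₁ := hblock.τ_lt_one
  have hsqrt_pos : 0 < Real.sqrt τ := Real.sqrt_pos.2 hτ₀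
  have hsqrt_lt : Real.sqrt τ < 1 := by
    rw [Real.sqrt_lt' one_pos, one_pow]
    exact hτ₁
  -- the amplitude: the block's gain, capped at `τ^{-3/2}` (energy cap `a²τ³ ≤ 1`)
  obtain ⟨a, hinv_lt, hcap, hle⟩ : ∃ a : ℝ, τ⁻¹ < a ∧ a ^ 2 * τ ^ 3 ≤ 1 ∧ a ≤ g := by
    refine ⟨min g (τ⁻¹ * (Real.sqrt τ)⁻¹), lt_min hg ?_, ?_, min_le_left _ _⟩
    · have h1 : 1 < (Real.sqrt τ)⁻¹ := (one_lt_inv₀ hsqrt_pos).2 hsqrt_lt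
      calc τ⁻¹ = τ⁻¹ * 1 := (mul_one _).symm
        _ < τ⁻¹ * (Real.sqrt τ)⁻¹ := mul_lt_mul_of_pos_left h1 (inv_pos.2 hτ₀)
    · have h0 : 0 ≤ min g (τ⁻¹ * (Real.sqrt τ)⁻¹) :=
        le_min ((inv_pos.2 hτ₀).trans hg).le (mul_nonneg (inv_pos.2 hτ₀).le (inv_pos.2 hsqrt_pos).le)
      have h2 : min g (τ⁻¹ * (Real.sqrt τ)⁻¹) ^ 2 ≤ (τ⁻¹ * (Real.sqrt τ)⁻¹) ^ 2 :=
        pow_le_pow_left₀ h0 (min_le_right _ _) 2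
      have hτne : τ ≠ 0 := hτ₀.ne'
      have h3 : (τ⁻¹ * (Real.sqrt τ)⁻¹) ^ 2 * τ ^ 3 = 1 := by
        rw [mul_pow, inv_pow, inv_pow, Real.sq_sqrt hτ₀.le]
        field_simp
      calc min g (τ⁻¹ * (Real.sqrt τ)⁻¹) ^ 2 * τ ^ 3 ≤ (τ⁻¹ * (Real.sqrt τ)⁻¹) ^ 2 * τ ^ 3 :=
          mul_le_mul_of_nonneg_right h2 (pow_nonneg hτ₀.le 3)
        _ = 1 := h3
  have hgain' : ∀ y : EuclideanSpace ℝ (Fin 3), a * ‖u 0 y‖ ≤ ‖u T (τ • y + z)‖ := fun y =>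
    (mul_le_mul_of_nonneg_right hle (norm_nonneg _)).trans (hgain y)
  -- the clock `σ = √(τ/a)`: `aσ² = τ`, `σ < 1`, `aσ > 1`
  obtain ⟨hσ₀, hσ₁, hcov, haσ, -⟩ := superCascade_params hτ₀ hτ₁ hinv_lt
  have hS : IsSuperBlock T ν₀ τ (Real.sqrt (τ / a)) a z G u := ⟨hblock, hσ₀, hcov, hinv_lt, hcap, hgain'⟩
  have hT₀ : 0 < blowupTime T (Real.sqrt (τ / a)) :=
    div_pos hblock.T_pos (by nlinarith [hS.σ_sq_lt_one])
  exact ⟨ν₀, hblock.ν₀_pos, G, glueG T (Real.sqrt (τ / a)) τ a z u,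
    fun t => normalisedPressure (glueG T (Real.sqrt (τ / a)) τ a z u t), hblock.isCompact,
    fun ν hν => hS.isWeakNSISolution_glueG hν,
    fun t _ => ⟨hS.contDiff_glueG_slice t, hS.tsupport_glueG_slice_subset t⟩,
    blowupTime T (Real.sqrt (τ / a)), blowupPoint τ z, hT₀,
    not_isRegularPoint_glueG hblock hσ₀ hσ₁ hS.one_lt_gain,
    exists_bound_glueG hblock hσ₀ hσ₁ hS.one_lt_gain.le,
    exists_rate_glueG hblock hσ₀ hσ₁ haσ⟩

end Summit.NavierStokesRegularity.NavierStokesRegularity.Theorems.TypeIliouvilleNoTypeIINegative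

end
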